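import Mathlib
import Summits.NavierStokesRegularity.NavierStokesRegularity.Theorems.EulerZoomLiouvillePowerGaugeEulerLiouvilleFadingTamePastTools
import HarnessLib.Audit

/-!
# Crux E `PowerGaugeEulerLiouville` (stmt-NavierStokesRegularity-19832): classical members with an EXPONENTIALLY FADING
# TAME PAST are irrotational, hence trivial (the physical form of line `logtime-breathers`, stub T2b)

Route `EulerZoomLiouville` (NavierStokesRegularity), crux E = Seregin's power-gauged ancient-Euler Liouville statement.
A CLASSICAL stratum with no self-similarity, symmetry, energy or far-field-decay hypothesis on the velocity ITSELF: a
classical Euler solution `(u, p)` on a past sub-slab `(−∞, T₁)` whose velocity FADES EXPONENTIALLY into the past,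
`‖u(t, y)‖ ≤ M e^{ct}` (`c > 0`), and whose velocity GRADIENT is TAME in the breathing variable `z = e^{−ct} y`,
`‖∇u(t, y)‖ ≤ C (1 + e^{−ct}‖y‖)^{−(1+ε)}` (`ε > 0`), is IRROTATIONAL on `(−∞, T₁)` (`FadingPast.curl_eq_zero`), and a member of
the class with such a past is trivial (`FadingPast.ae_eq_zero_of_gauge_of_fadingTamePast`, via the tree's
`PastIrrotational.ae_eq_zero_of_gauge_of_pastIrrotational`).  The LOG-TIME BREATHERS `u(τ, y) = e^{cτ} V(e^{−cτ} y)` with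
`c > 0` and a tame profile `‖∇V(z)‖ ≤ C(1+‖z‖)^{−(1+ε)}` of line `logtime-breathers` (crux dir
`Cruxes/PowerGaugeEulerLiouville/Lines/logtime-breathers.md`, stub T2b `stub_tameBreather`) are exactly of this form
(sequel `…LogtimeBreatherTame`).

MECHANISM (Lagrangian, physical variables — no profile equation is needed).  Fix `τ < T₁` and `x`, and follow the fluid
particle `P(r) = φ(r, τ, x)` backward.  Since `‖P′(r)‖ ≤ M e^{cr}` is integrable on `(−∞, τ]`, the particle has travelled a
finite distance: `‖P(r) − P(r₁)‖ ≤ (M/c) e^{c r₁}` for `r ≤ r₁` (`FadingPast.norm_evolutionMap_sub_le`).  EITHER the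
particle is TRAPPED, `‖P(r)‖ ≤ (M/c) e^{cr}` for every `r ≤ τ` — the trapped set `T_τ` is closed and, being squeezed by the
volume-preserving maps `φ(r, τ, ·)` into the balls `B(0, (M/c)e^{cr})`, `r → −∞`, is Lebesgue-NULL
(`FadingPast.volume_trapped_eq_zero`) — OR at some time `r₁ ≤ τ` it is outside that ball, and then it stays at distance
`≥ δ > 0` from the origin for all `r ≤ r₁`, where the tame bound gives the INTEGRABLE stretching rate
`‖∇u(r, P(r))‖ ≤ C δ^{−(1+ε)} e^{(1+ε)cr}` and the vanishing source `‖ω(σ, P(σ))‖ ≤ 4‖∇u(σ, P(σ))‖ → 0`; the Cauchy formula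
`ω(r₁, P(r₁)) = ∇φ(r₁, σ, ·)(P(σ)) ω(σ, P(σ))` with the PATHWISE Grönwall bound
`‖∇φ(r₁, σ, ·)(P(σ))‖ ≤ exp ∫_σ^{r₁} ‖∇u(r, P(r))‖ dr` (`FadingPast.norm_fderiv_evolutionMap_le_exp_integral_path`, file `…FadingTamePastTools`) gives
`ω(r₁, P(r₁)) = 0` as `σ → −∞` (`FadingPast.curl_eq_zero_of_escape`), and the Cauchy formula from `r₁` to `τ` transports the
zero (`FadingPast.curl_eq_zero_of_curl_eq_zero_earlier`).  So `curl u(τ) = 0` off the null closed set `T_τ`, hence everywhere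
by continuity.

WHAT THIS IS NOT: not NS regularity, not the crux E — a classical stratum for the lead skeleton
`Cruxes/PowerGaugeEulerLiouville/Lines/birth.lean` (interim LEAD ns-typeII-p2 g10). [folklore; MajdaBertozziCUP2002 §1.6 Prop 1.8
(1.51), §2.5 (2.115)–(2.117), §4.2 (4.46)–(4.47); line card `Lines/logtime-breathers.md` T2b]
-/

noncomputable section

set_option linter.dupNamespace false

open MeasureTheory Set Filter Topology Metric Function
open scoped NNReal ENNReal ContDiff

namespace Summit.NavierStokesRegularity.NavierStokesRegularity.Theorems.PowerGaugeEulerLiouville.FadingPast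

open Literature.Analysis Literature.Analysis.FluidPDE

/-! ### The trapped set and the conclusion -/

section Fading

variable {u : ℝ → EuclideanSpace ℝ (Fin 3) → EuclideanSpace ℝ (Fin 3)} {p : ℝ → EuclideanSpace ℝ (Fin 3) → ℝ}
  {T₁ c M C ε : ℝ}

/-! The TRAPPED SET at time `τ` is `{x | ∀ r ≤ τ, ‖φ(r, τ, x)‖ ≤ (M/c) e^{cr}}`: the points whose backward trajectory
converges to the origin at the fading rate (written out in each statement; no definition is introduced). -/

/-- The trapped set is closed (continuity of the particle-trajectory maps). [folklore] -/
theorem isClosed_trapped (hcl : IsClassicalEulerSolutionOn (Iio T₁) 0 u p)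
    (hL : ODE.IsUniformlyLipschitzOn u (Iio T₁)) {τ : ℝ} (hτ : τ < T₁) : IsClosed {x : EuclideanSpace ℝ (Fin 3) | ∀ r : ℝ, r ≤ τ → ‖ODE.evolutionMap u τ r x‖ ≤ M / c * Real.exp (c * r)} := by
  have h : {x : EuclideanSpace ℝ (Fin 3) | ∀ r : ℝ, r ≤ τ → ‖ODE.evolutionMap u τ r x‖ ≤ M / c * Real.exp (c * r)} =
      ⋂ r : ℝ, ⋂ (_ : r ≤ τ), {x | ‖ODE.evolutionMap u τ r x‖ ≤ M / c * Real.exp (c * r)} := by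
    ext x; simp
  rw [h]
  refine isClosed_iInter fun r => isClosed_iInter fun hr => ?_
  have hcont : Continuous (ODE.evolutionMap u τ r) :=
    (hL.contDiff_evolutionMap (convex_Iio _) (uniqueDiffOn_Iio _) le_top hcl.smooth_velocity hτ
      (lt_of_le_of_lt hr hτ)).continuous
  exact isClosed_le (continuous_norm.comp hcont) continuous_const

/-- **THE TRAPPED SET IS NULL**: the volume-preserving maps `φ(r, τ, ·)` squeeze it into the balls `B(0, (M/c) e^{cr})`,
`r → −∞`. [cite: MajdaBertozziCUP2002, §1.3 Def. 1.1, Prop. 1.4 (incompressibility)] -/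
theorem volume_trapped_eq_zero (hcl : IsClassicalEulerSolutionOn (Iio T₁) 0 u p)
    (hL : ODE.IsUniformlyLipschitzOn u (Iio T₁)) (hc : 0 < c) (hM : 0 ≤ M) {τ : ℝ} (hτ : τ < T₁) :
    volume {x : EuclideanSpace ℝ (Fin 3) | ∀ r : ℝ, r ≤ τ → ‖ODE.evolutionMap u τ r x‖ ≤ M / c * Real.exp (c * r)} = 0 := by
  have hS : Convex ℝ (Iio T₁) := convex_Iio _
  have hU : UniqueDiffOn ℝ (Iio T₁) := uniqueDiffOn_Iio _
  set T : Set (EuclideanSpace ℝ (Fin 3)) := {x : EuclideanSpace ℝ (Fin 3) | ∀ r : ℝ, r ≤ τ → ‖ODE.evolutionMap u τ r x‖ ≤ M / c * Real.exp (c * r)} with hT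
  have hmeas : MeasurableSet T := (isClosed_trapped hcl hL hτ).measurableSet
  set V₁ : ℝ≥0∞ := volume (ball (0 : EuclideanSpace ℝ (Fin 3)) 1) with hV₁
  have hV₁top : V₁ ≠ ⊤ := measure_ball_lt_top.ne
  -- squeezing: `vol T ≤ (M/c)³ e^{3cr} · vol B₁` for every `r ≤ τ`
  have hsq : ∀ r : ℝ, r ≤ τ →
      volume T ≤ ENNReal.ofReal ((M / c * Real.exp (c * r)) ^ 3) * V₁ := by
    intro r hr
    have hrT : r < T₁ := lt_of_le_of_lt hr hτ
    have hR : 0 ≤ M / c * Real.exp (c * r) := mul_nonneg (div_nonneg hM hc.le) (Real.exp_pos _).le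
    have himg : ODE.evolutionMap u τ r '' T ⊆
        closedBall (0 : EuclideanSpace ℝ (Fin 3)) (M / c * Real.exp (c * r)) := by
      rintro _ ⟨x, hx, rfl⟩
      rw [mem_closedBall, dist_zero_right]
      exact hx r hr
    calc volume T
        = volume (ODE.evolutionMap u τ r '' T) :=
          (KelvinPhysical.volume_image_evolutionMap hcl hL hS hU hτ hrT hmeas).symm
      _ ≤ volume (closedBall (0 : EuclideanSpace ℝ (Fin 3)) (M / c * Real.exp (c * r))) := measure_mono himg
      _ = ENNReal.ofReal ((M / c * Real.exp (c * r)) ^ 3) * V₁ := by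
          rw [Measure.addHaar_closedBall _ _ hR, finrank_euclideanSpace_fin]
  -- the right-hand side tends to `0` as `r → −∞`
  have hlim : Tendsto (fun r : ℝ => ENNReal.ofReal ((M / c * Real.exp (c * r)) ^ 3) * V₁) atBot (𝓝 0) := by
    have h1 : Tendsto (fun r : ℝ => c * r) atBot atBot := tendsto_id.const_mul_atBot hc
    have h2 : Tendsto (fun r : ℝ => (M / c * Real.exp (c * r)) ^ 3) atBot (𝓝 ((M / c * 0) ^ 3)) :=
      ((Real.tendsto_exp_atBot.comp h1).const_mul (M / c)).pow 3
    rw [mul_zero, zero_pow three_ne_zero] at h2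
    have h3 := ENNReal.tendsto_ofReal h2
    rw [ENNReal.ofReal_zero] at h3
    have h4 := ENNReal.Tendsto.mul_const h3 (Or.inr hV₁top)
    rwa [zero_mul] at h4
  refine le_antisymm (ge_of_tendsto hlim ((eventually_le_atBot τ).mono fun r hr => hsq r hr)) bot_le

/-- **OFF THE TRAPPED SET THE VORTICITY VANISHES**: if `x ∉ T_τ`, some `r₁ ≤ τ` has `‖φ(r₁, τ, x)‖ > (M/c) e^{c r₁}`; the
particle then stays at distance `≥ δ = ‖φ(r₁, τ, x)‖ − (M/c)e^{c r₁} > 0` from the origin before `r₁` (finite displacement), so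
`ω(r₁, φ(r₁, τ, x)) = 0` (`curl_eq_zero_of_escape`), and the Cauchy formula from `r₁` to `τ` transports the zero. [folklore] -/
theorem curl_eq_zero_of_not_mem_trapped (hcl : IsClassicalEulerSolutionOn (Iio T₁) 0 u p) (hc : 0 < c) (hε : 0 < ε)
    (hvel : ∀ s : ℝ, s < T₁ → ∀ y, ‖u s y‖ ≤ M * Real.exp (c * s))
    (hgrad : ∀ s : ℝ, s < T₁ → ∀ y, ‖fderiv ℝ (u s) y‖ ≤ C * (1 + Real.exp (-(c * s)) * ‖y‖) ^ (-(1 + ε)))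
    {τ : ℝ} (hτ : τ < T₁) {x : EuclideanSpace ℝ (Fin 3)}
    (hx : x ∉ {x : EuclideanSpace ℝ (Fin 3) | ∀ r : ℝ, r ≤ τ → ‖ODE.evolutionMap u τ r x‖ ≤ M / c * Real.exp (c * r)}) :
    curl (u τ) x = 0 := by
  obtain ⟨K, hK, hL⟩ := lipschitz_and_isUniformlyLipschitzOn hcl hε hgrad
  simp only [mem_setOf_eq, not_forall, not_le, exists_prop] at hx
  obtain ⟨r₁, hr₁, hbig⟩ := hx
  have hr₁T : r₁ < T₁ := lt_of_le_of_lt hr₁ hτ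
  set x₁ := ODE.evolutionMap u τ r₁ x with hx₁
  set δ : ℝ := ‖x₁‖ - M / c * Real.exp (c * r₁) with hδ
  have hδ0 : 0 < δ := by rw [hδ]; linarith
  have hfar : ∀ r : ℝ, r ≤ r₁ → δ ≤ ‖ODE.evolutionMap u r₁ r x₁‖ := by
    intro r hr
    have h1 := norm_evolutionMap_sub_le hL hc hvel hr₁T hr x₁
    have h2 := norm_sub_norm_le x₁ (ODE.evolutionMap u r₁ r x₁)
    rw [← norm_neg, neg_sub] at h1
    rw [hδ]; linarith
  have hzero : curl (u r₁) x₁ = 0 := curl_eq_zero_of_escape hcl hc hε hgrad hr₁T x₁ hδ0 hfar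
  exact curl_eq_zero_of_curl_eq_zero_earlier hcl hK hr₁T hτ x hzero

/-- **A CLASSICAL EULER FLOW WITH AN EXPONENTIALLY FADING TAME PAST IS IRROTATIONAL**: `‖u(t,y)‖ ≤ M e^{ct}`,
`‖∇u(t,y)‖ ≤ C(1 + e^{−ct}‖y‖)^{−(1+ε)}` on `(−∞, T₁)` (`c, ε > 0`) ⇒ `curl u(τ) ≡ 0` for every `τ < T₁` (the vorticity
vanishes off the closed null trapped set, hence everywhere by continuity). [folklore; line `logtime-breathers` T2b] -/
theorem curl_eq_zero (hcl : IsClassicalEulerSolutionOn (Iio T₁) 0 u p) (hc : 0 < c) (hε : 0 < ε)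
    (hvel : ∀ s : ℝ, s < T₁ → ∀ y, ‖u s y‖ ≤ M * Real.exp (c * s))
    (hgrad : ∀ s : ℝ, s < T₁ → ∀ y, ‖fderiv ℝ (u s) y‖ ≤ C * (1 + Real.exp (-(c * s)) * ‖y‖) ^ (-(1 + ε)))
    {τ : ℝ} (hτ : τ < T₁) (x : EuclideanSpace ℝ (Fin 3)) : curl (u τ) x = 0 := by
  obtain ⟨K, -, hL⟩ := lipschitz_and_isUniformlyLipschitzOn hcl hε hgrad
  have hM : 0 ≤ M := by
    have h := hvel τ hτ 0
    exact le_of_mul_le_mul_right ((norm_nonneg _).trans h |> le_trans (by simp)) (Real.exp_pos (c * τ))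
  set T : Set (EuclideanSpace ℝ (Fin 3)) := {x : EuclideanSpace ℝ (Fin 3) | ∀ r : ℝ, r ≤ τ → ‖ODE.evolutionMap u τ r x‖ ≤ M / c * Real.exp (c * r)} with hT
  have hnull : volume T = 0 := volume_trapped_eq_zero hcl hL hc hM hτ
  have hdense : Dense Tᶜ := by
    rw [← interior_eq_empty_iff_dense_compl]
    by_contra hne
    have hpos := (isOpen_interior.measure_pos volume (nonempty_iff_ne_empty.2 hne))
    have hle : volume (interior T) ≤ 0 := hnull ▸ measure_mono interior_subset
    exact absurd (lt_of_lt_of_le hpos hle) (lt_irrefl _)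
  have hcont : Continuous (curl (u τ)) :=
    continuous_curl ((hcl.contDiff_velocity hτ).of_le (by exact_mod_cast le_top))
  have h := Continuous.ext_on hdense hcont continuous_const fun y hy =>
    curl_eq_zero_of_not_mem_trapped hcl hc hε hvel hgrad hτ hy
  exact congrFun h x

/-! ### Member level -/

/-- **MEMBERS WITH AN EXPONENTIALLY FADING TAME PAST ARE TRIVIAL.**  Crux hypotheses verbatim (`0 < ρ ≤ ½`) + `(u, p)`
classical on a past sub-slab `(−∞, T₁)`, `T₁ ≤ 0`, with `‖u(t,y)‖ ≤ M e^{ct}` and `‖∇u(t,y)‖ ≤ C(1 + e^{−ct}‖y‖)^{−(1+ε)}` there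
(`c, ε > 0`; nothing assumed on `[T₁, 0)`) ⇒ `u = 0` a.e. on `(−∞, 0) × ℝ³`: the past is classical, incompressible and
irrotational (`curl_eq_zero`), and the tree's `PastIrrotational.ae_eq_zero_of_gauge_of_pastIrrotational` (harmonic slices killed
by the `A`-gauge, then the energy stratum) concludes.  The tame log-time breathers (`c > 0`) of line `logtime-breathers` are the
model case (sequel file). [folklore; line card `Lines/logtime-breathers.md` T2b] -/
theorem ae_eq_zero_of_gauge_of_fadingTamePast {ρ : ℝ} (hρ : 0 < ρ) (hρh : ρ ≤ 1 / 2)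
    {H : ℝ → EuclideanSpace ℝ (Fin 3) → EuclideanSpace ℝ (Fin 3) →L[ℝ] EuclideanSpace ℝ (Fin 3)} {c₀ : ℝ≥0}
    (hsw : IsSuitableWeakSolutionOn (slab (EuclideanSpace ℝ (Fin 3)) (Iio 0) isOpen_Iio) 0 0 u p)
    (hH : HasWeakSpatialGradientOn (slab (EuclideanSpace ℝ (Fin 3)) (Iio 0) isOpen_Iio) u H)
    (hgauge : ∀ a : ℝ, 0 < a →
      ENNReal.ofReal (a ^ (2 * ρ)) * cknA a (0 : ℝ × EuclideanSpace ℝ (Fin 3)) u +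
          ENNReal.ofReal (a ^ ρ) * cknE a (0 : ℝ × EuclideanSpace ℝ (Fin 3)) H +
        ENNReal.ofReal (a ^ (2 * ρ)) * cknD a (0 : ℝ × EuclideanSpace ℝ (Fin 3)) p ≤ (c₀ : ℝ≥0∞))
    (hT₁ : T₁ ≤ 0) (hcl : IsClassicalEulerSolutionOn (Iio T₁) 0 u p) (hc : 0 < c) (hε : 0 < ε)
    (hvel : ∀ s : ℝ, s < T₁ → ∀ y, ‖u s y‖ ≤ M * Real.exp (c * s))
    (hgrad : ∀ s : ℝ, s < T₁ → ∀ y, ‖fderiv ℝ (u s) y‖ ≤ C * (1 + Real.exp (-(c * s)) * ‖y‖) ^ (-(1 + ε))) :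
    uncurry u =ᵐ[volume.restrict (Iio (0 : ℝ) ×ˢ (univ : Set (EuclideanSpace ℝ (Fin 3))))] 0 :=
  PastIrrotational.ae_eq_zero_of_gauge_of_pastIrrotational hρ hρh hsw hH hgauge hT₁
    (fun τ hτ => (hcl.contDiff_velocity hτ).of_le (by norm_cast))
    (fun τ hτ => hcl.divFree τ hτ) (fun τ hτ x => curl_eq_zero hcl hc hε hvel hgrad hτ x)

end Fading

end Summit.NavierStokesRegularity.NavierStokesRegularity.Theorems.PowerGaugeEulerLiouville.FadingPast
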